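import Summits.CriticalPhenomena.Ising3DConformalLimit.Theorems.EnergyNotSigmaSquaredGapForcesFarMergingScreeningDefsUnpin
import Summits.CriticalPhenomena.Ising3DConformalLimit.Theorems.EnergyNotSigmaSquaredGapForcesFarMergingRootOpacity
import Summits.CriticalPhenomena.Ising3DConformalLimit.Theorems.EnergyNotSigmaSquaredGapForcesFarMergingSandwichNearPinchFloorAux

/-! # `HazardRelocation`: positivity of the ladder, the current dictionary of the screening ratio,
# and the reduction to drop comparability
(line `screening-form-lemma-a1` of crux `GapForcesFarMerging`, item stmt-CriticalPhenomena-4468;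
helper file of the open stub `stub_hazardRelocation : HazardRelocation`, currency of `…ScreeningDefsUnpin.lean`)

`HazardRelocation` concludes, at the bounded-aspect far scale `M = 2^{k+3}`, `0 < A(2^k;M)` AND a relative
drop of the ladder `A(r;m) = pinchScreen n r m` across the octave `k`, from the same drop at a far scale
`m ≥ M`. (i) POSITIVITY is settled for every radius and far scale: `0 < pinchScreen n r m` for `1 ≤ r < m`,
`n ≥ 2m+1` (`pinchScreen_pos`; the landed `rootFloor` only reaches `m ≥ m₀(r)`). On the cylinder "no bond
meeting the escape ray `R = {(0,1,t) : 0 ≤ t ≤ r}` or the site `dn m` is open" the ray is closed and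
`dn m ∉ C(0)`, so the integrand is at least the root ratio `S_{e₂ dn}(Λ_r ∖ R) ≥ η₁(r) > 0`
(`screening_le_screenWeight`, `screening_root_lower`); the cylinder has probability
`≥ e^{-2β|F|}⟨σ₀σ_{up m}⟩_{Λ_n∖(R ∪ {dn m})}/⟨σ₀σ_{up m}⟩_{Λ_n}` (hole cylinder floor `holeCylinder_real_ge` of line
`one-cluster-depletion-sandwich`: factorisation of `P^{A,∅}` on cylinders, ADS15 (2.13)–(2.14), tilt identity),
positive by the GKS II chain `0 → (2m,0,0) → up m` off `R ∪ {dn m}` (`isingCorr_up_hole_pos`).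
(ii) THE CURRENT DICTIONARY OF THE SCREENING RATIO (`screening_eq_sourcedAvoid_div`):
`S⁽ⁿ⁾_{ab}(T) = P^{ab}_{Λ_n}[n ≡ 0 on ℰ(T)] / P^{∅}_{Λ_n}[n ≡ 0 on ℰ(T)]` — so the dependence of the screening
functional on its far probe end is that of a LOCAL avoidance probability of ONE sourced current on its far source.
(iii) THE DROP TRANSFER is reduced to its exact far-end-insensitivity content over `pinchScreen`:
`HazardRelocation` follows from comparability UP TO A CONSTANT of the relative octave DROPS
`(A(2^k;·) - A(2^{k+1};·))/A(2^k;·)` at the far scales `m` and `M` (`hazardRelocation_of_dropComparability`,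
`c' = c/K`), or from ASYMPTOTIC (`1+δ`, `δ → 0` in `k`) insensitivity of the survival ratios
`A(2^{k+1};·)/A(2^k;·)` (`hazardRelocation_of_ratioInsensitivity`, `c' = c/2`); survivals comparable up to a
fixed `K > 1` would only transfer drops `c > 1 - 1/K` (and drops are proper fractions, `lt_one_of_pinchScreen_drop`;
small drops suffice, `hazardRelocation_of_lt_one`). Both inputs are ratio-form mixing statements for sourced
critical double currents on `ℤ³`, uniform in the scale — open (Panis 2025 Thm 2.4/3.1 is the qualitative shadow).
References: Aizenman–Duminil-Copin–Sidoravicius 2015, §2.2 (2.13)–(2.14); Aizenman–Duminil-Copin 2021, §3.1,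
§6.2, App. A Lemma A.1; Panis, PTRF 194 (2025), Thm 3.1; Friedli–Velenik 2017, §3.8.1. -/

noncomputable section

namespace Summit.CriticalPhenomena.Ising3DConformalLimit.EnergyNotSigmaSquaredGapForcesFarMerging

open scoped symmDiff ENNReal
open MeasureTheory Filter Finset
open Literature.Probability.LatticeModels Literature.Probability.Percolation
open Summit.CriticalPhenomena.Ising3DConformalLimit.Theorems.GapForcesFarMerging.Negative (e₁ e₂ cc2 xR up dn)
open Summit.CriticalPhenomena.Ising3DConformalLimit.GapForcesFarMergingScreening
open Summit.CriticalPhenomena.Ising3DConformalLimit.EnergyNotSigmaSquaredGapForcesFarMergingSandwich.NearPinchFloorProof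
  (isingExpect_spinProduct_expNegBonds_hole holeCylinder_real_ge)

/-! ### The strand `0 → up m` off the ray and off the far probe point -/

/-- **The depleted strand correlation is positive**: `⟨σ₀σ_{up m}⟩^∅_{Λ_n ∖ (R ∪ {dn m})} > 0` for
`1 ≤ r < m`, `n ≥ 2m`, `R = {(0,1,t) : 0 ≤ t ≤ r}` (GKS II chain along `0 → (2m,0,0) → (2m,m,0) = up m`,
which avoids the ray `{x₁ = 1} ∩ Λ_r` and `dn m = (2m,-m,0)`). [cite: FriedliVelenik2017, §3.8.1, p. 141] -/
theorem isingCorr_up_hole_pos {r m n : ℕ} (hr : 1 ≤ r) (hm : r < m) (hn : 2 * m ≤ n) :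
    0 < isingCorr (zdGraph 3)
      (box 3 n \ (((box 3 r).filter fun x : Site 3 => x 0 = 0 ∧ x 1 = 1 ∧ 0 ≤ x 2) ∪ {dn m}))
      (criticalBeta 3) 0 .free ({0} ∆ {up m}) := by
  have hβ : 0 < criticalBeta 3 := criticalBeta_pos_holds (d := 3) (by norm_num)
  set Λ' := box 3 n \ (((box 3 r).filter fun x : Site 3 => x 0 = 0 ∧ x 1 = 1 ∧ 0 ≤ x 2) ∪ {dn m}) with hΛ'
  obtain ⟨hu0, hu1, hu2⟩ := up_coords m
  obtain ⟨hd0, hd1, hd2⟩ := dn_coords m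
  -- membership in `Λ'` by coordinates
  have hmemΛ' : ∀ x : Site 3, ((0 ≤ x 0 ∧ x 0 ≤ 2 * m) ∧ (0 ≤ x 1 ∧ x 1 ≤ m) ∧ x 2 = 0) →
      (x 1 = 1 → x 0 ≠ 0) → x ∈ Λ' := by
    intro x hx hx'
    rw [hΛ', Finset.mem_sdiff, mem_box_three, Finset.mem_union, Finset.mem_filter, Finset.mem_singleton]
    refine ⟨by omega, ?_⟩
    rintro (⟨-, h0, h1, -⟩ | h)
    · exact hx' h1 h0
    · have := congr_fun h 1; rw [hd1] at this; omega
  -- the corner `p = (2m,0,0)`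
  set p : Site 3 := Function.update (0 : Site 3) 0 ((0 : ℤ) + ((2 * m : ℕ) : ℤ)) with hp
  have hp_coords : p 0 = 2 * m ∧ p 1 = 0 ∧ p 2 = 0 := by refine ⟨?_, ?_, ?_⟩ <;> simp [hp]
  -- first leg `0 → p` along the axis `e₁`
  have hleg1 : 0 < isingCorr (zdGraph 3) Λ' (criticalBeta 3) 0 .free
      ({Function.update (0 : Site 3) 0 (0 : ℤ)} ∆ {p}) := by
    refine isingCorr_axisMove_pos (Λ' := Λ') hβ (0 : Site 3) 0 0 (2 * m) fun t ht => hmemΛ' _ ?_ ?_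
    · refine ⟨⟨by simp, by simp; omega⟩, ⟨by simp, by simp⟩, by simp⟩
    · intro h; simp at h
  have hstart1 : Function.update (0 : Site 3) 0 (0 : ℤ) = 0 := by funext i; fin_cases i <;> simp
  rw [hstart1] at hleg1
  -- second leg `p → up m` along the axis `e₂`
  have hleg2 : 0 < isingCorr (zdGraph 3) Λ' (criticalBeta 3) 0 .free
      ({Function.update p 1 (0 : ℤ)} ∆ {Function.update p 1 ((0 : ℤ) + (m : ℕ))}) := by
    refine isingCorr_axisMove_pos (Λ' := Λ') hβ p 1 0 m fun t ht => hmemΛ' _ ?_ ?_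
    · refine ⟨⟨?_, ?_⟩, ⟨?_, ?_⟩, ?_⟩ <;> (simp [hp]; try omega)
    · intro _ h; simp [hp] at h; omega
  have hstart2 : Function.update p 1 (0 : ℤ) = p := by funext i; fin_cases i <;> simp [hp]
  have hend2 : Function.update p 1 ((0 : ℤ) + (m : ℕ)) = up m := by
    funext i; fin_cases i <;> simp [hp, hu0, hu1, hu2]
  rw [hstart2, hend2] at hleg2
  -- memberships of the three chain points
  have h0Λ : (0 : Site 3) ∈ Λ' := hmemΛ' 0 ⟨⟨by simp, by simp⟩, ⟨by simp, by simp⟩, by simp⟩ (fun h => by simp at h)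
  have hpΛ : p ∈ Λ' := hmemΛ' p ⟨⟨by omega, by omega⟩, ⟨by omega, by omega⟩, hp_coords.2.2⟩
    (fun h => by omega)
  have hupΛ : up m ∈ Λ' := hmemΛ' (up m) ⟨⟨by omega, by omega⟩, ⟨by omega, by omega⟩, hu2⟩ (fun h => by omega)
  exact lt_of_lt_of_le (mul_pos hleg1 hleg2) (isingCorr_pair_chain _ h0Λ hpΛ hupΛ hβ.le)

/-! ### Positivity of the ladder -/

/-- **THE ONE-PINCH SCREENING LADDER IS POSITIVE**: `0 < pinchScreen n r m` for `1 ≤ r < m` and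
`n ≥ 2m + 1` — on the cylinder "no bond meeting `R ∪ {dn m}` is open" (probability
`≥ e^{-2β|F|}⟨σ₀σ_{up m}⟩_{Λ_n∖(R∪{dn m})}/⟨σ₀σ_{up m}⟩_{Λ_n} > 0`: the hole cylinder floor `holeCylinder_real_ge`
of line `one-cluster-depletion-sandwich` and the depleted strand positivity) the ray is closed and `dn m` is
isolated, so the integrand is at least the root ratio `S_{e₂ dn}(Λ_r ∖ R) ≥ η₁(r) > 0`; elsewhere it is
nonnegative (`screening_mul_real_le_pinchScreen`). [cite: AizenmanDuminilCopinAnnals2021, Appendix A, Lemma A.1] -/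
theorem pinchScreen_pos {n r m : ℕ} (hr : 1 ≤ r) (hm : r < m) (hn : 2 * m + 1 ≤ n) : 0 < pinchScreen n r m := by
  classical
  have hβ : 0 < criticalBeta 3 := criticalBeta_pos_holds (d := 3) (by norm_num)
  have hn' : 2 * m ≤ n := by omega
  obtain ⟨η₁, hη₁, hs⟩ := screening_root_lower r hr
  set R : Finset (Site 3) := (box 3 r).filter fun x : Site 3 => x 0 = 0 ∧ x 1 = 1 ∧ 0 ≤ x 2 with hR
  set R' : Finset (Site 3) := R ∪ {dn m} with hR'
  set F := edgesTouching (zdGraph 3) R' with hF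
  set A : Finset (Site 3) := {0} ∆ {up m} with hA
  set μ := doubleCurrentMeasure (freeBoxGraph 3 n) (criticalBeta 3) (boxSources 3 n A) ∅ with hμ
  obtain ⟨hu0, hu1, hu2⟩ := up_coords m
  obtain ⟨hd0, hd1, hd2⟩ := dn_coords m
  have hupn : up m ∈ box 3 n := by rw [mem_box_three, hu0, hu1, hu2]; omega
  have hne : (0 : Site 3) ≠ up m := fun h => by have := congr_fun h 0; rw [hu0] at this; simp at this; omega
  have hAn : A ⊆ box 3 n := symmDiff_singleton_subset_box 3 (zero_mem_box 3 n) hupn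
  have hAeven : Even #A := by rw [hA, card_pair_symmDiff hne]; exact even_two
  have hRr : R ⊆ box 3 r := Finset.filter_subset _ _
  have hR'box : R' ⊆ box 3 (2 * m) := by
    intro x hx
    rcases Finset.mem_union.1 hx with hx | hx
    · exact box_mono 3 (by omega) (hRr hx)
    · rw [Finset.mem_singleton.1 hx, mem_box_three, hd0, hd1, hd2]; omega
  have hFn : F ⊆ edgesIn (zdGraph 3) (box 3 n) := edgesTouching_subset_edgesIn_box (by omega) hR'box
  -- the cylinder lies in the ray event
  set Cyl : Set (Current (freeBoxGraph 3 n) × Current (freeBoxGraph 3 n)) :=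
    {p | ∀ e ∈ F, e ∉ sourcedTrace 3 n p} with hCyl
  set E : Set (Current (freeBoxGraph 3 n) × Current (freeBoxGraph 3 n)) :=
    {p | (∀ x ∈ R, ∀ z : Site 3, s(x, z) ∉ sourcedTrace 3 n p) ∧ dn m ∉ openCluster (sourcedTrace 3 n p) 0} with hE
  have hsub : Cyl ⊆ E := fun p hp => by
    have hall : ∀ x ∈ R', ∀ z : Site 3, s(x, z) ∉ sourcedTrace 3 n p := ray_closed_of_cylinder hp
    refine ⟨fun x hx => hall x (Finset.mem_union_left _ hx), ?_⟩
    refine not_mem_openCluster_of_closed (fun h => ?_) (hall (dn m) (Finset.mem_union_right _ (Finset.mem_singleton_self _)))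
    have := congr_fun h 1; rw [hd1] at this; simp at this; omega
  -- the cylinder has positive probability (hole cylinder floor of the sandwich line, depleted strand positivity)
  have hA' : A ⊆ box 3 n \ R' := by
    refine pair_symmDiff_subset ?_ ?_
    · rw [Finset.mem_sdiff, hR', Finset.mem_union, hR, Finset.mem_filter, Finset.mem_singleton]
      refine ⟨zero_mem_box 3 n, ?_⟩
      rintro (⟨-, -, h1, -⟩ | h)
      · simp at h1
      · have := congr_fun h 1; rw [hd1] at this; simp at this; omega
    · rw [Finset.mem_sdiff, hR', Finset.mem_union, hR, Finset.mem_filter, Finset.mem_singleton]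
      refine ⟨hupn, ?_⟩
      rintro (⟨hbox, -, -, -⟩ | h)
      · rw [mem_box_three, hu0] at hbox; omega
      · have := congr_fun h 1; rw [hu1, hd1] at this; omega
  have hcyl : 0 < μ.real Cyl := by
    have hden : 0 < isingCorr (zdGraph 3) (box 3 n) (criticalBeta 3) 0 .free A := isingCorr_free_box_pos 3 hβ hAn hAeven
    have hhole : 0 < isingCorr (zdGraph 3) (box 3 n \ R') (criticalBeta 3) 0 .free A := isingCorr_up_hole_pos hr hm hn'
    exact lt_of_lt_of_le (mul_pos (Real.exp_pos _) (div_pos hhole hden)) (holeCylinder_real_ge hβ hFn hA' hAeven)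
  -- assemble
  haveI : IsProbabilityMeasure μ := isProbabilityMeasure_doubleCurrentMeasure_holds _ hβ.le
    (currentSum_boxSources_pos 3 hβ hAn hAeven).ne' (currentSum_empty_pos' _ _).ne'
  have hE_pos : 0 < μ.real E := lt_of_lt_of_le hcyl (measureReal_mono hsub (measure_ne_top μ _))
  have h1 := hs m hm n hn'
  have h2 := screening_mul_real_le_pinchScreen (r := r) hr hm hn'
  exact lt_of_lt_of_le (mul_pos (lt_of_lt_of_le hη₁ h1) hE_pos) h2

/-- **Eventual positivity of the ladder**: for `1 ≤ r < m`, `0 < pinchScreen n r m` for all large `n`. [folklore] -/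
theorem pinchScreen_eventually_pos {r m : ℕ} (hr : 1 ≤ r) (hm : r < m) :
    ∀ᶠ n : ℕ in atTop, 0 < pinchScreen n r m :=
  (eventually_ge_atTop (2 * m + 1)).mono fun _ hn => pinchScreen_pos hr hm hn

/-- **Positivity of the dyadic ladder at every far scale `m ≥ 2^{k+3}`**, for all large `n` — the first
conjunct of the conclusion of `HazardRelocation` (`m = 2^{k+3}`) and of the hypothesis of `Unpin`. [folklore] -/
theorem pinchScreen_dyadic_eventually_pos (k m : ℕ) (hm : 2 ^ (k + 3) ≤ m) :
    ∀ᶠ n : ℕ in atTop, 0 < pinchScreen n (2 ^ k) m :=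
  pinchScreen_eventually_pos Nat.one_le_two_pow (lt_of_lt_of_le (Nat.pow_lt_pow_right (by norm_num) (by omega)) hm)

/-- **Positivity of the ladder** (registered form of `pinchScreen_pos`). [cite: AizenmanDuminilCopinAnnals2021, Appendix A, Lemma A.1] -/
theorem pinchScreen_pos_of_lt : ∀ r m n : ℕ, 1 ≤ r → r < m → 2 * m + 1 ≤ n → 0 < pinchScreen n r m :=
  fun _ _ _ hr hm hn => pinchScreen_pos hr hm hn

/-! ### The current dictionary of the screening ratio -/

/-- **THE SCREENING RATIO IS A RATIO OF SINGLE-CURRENT AVOIDANCE PROBABILITIES.** For an obstacle `T`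
with `ℰ(T) ⊆ ℰ_{Λ_n}` and probe points `a, b ∈ Λ_n ∖ T`:
`S⁽ⁿ⁾_{ab}(T) = ⟨σ_aσ_b⟩_{Λ_n∖T}/⟨σ_aσ_b⟩_{Λ_n} = P^{ab}_{Λ_n}[n ≡ 0 on ℰ(T)] / P^{∅}_{Λ_n}[n ≡ 0 on ℰ(T)]`,
the avoidance probabilities (`Z_{Λ_n∖ℰ(T)}(·)/Z_{Λ_n}(·)`, as generating sums of free box currents) of ONE
free current with sources `{a,b}` resp. `∅` — ADS15 (2.13)–(2.14) for both, the `cosh`/vacuum tilt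
`⟨e^{-βK}⟩` cancelling in the ratio. So the dependence of the screening functional on its far probe end `b`
is that of a LOCAL avoidance probability of a single sourced current on its far source. [cite: AizenmanDuminilCopinSidoraviciusCMP2015, §2.2, eqs. (2.13)–(2.14)] -/
theorem screening_eq_sourcedAvoid_div {n : ℕ} {T : Finset (Site 3)}
    (hF : edgesTouching (zdGraph 3) T ⊆ edgesIn (zdGraph 3) (box 3 n)) {a b : Site 3}
    (ha : a ∈ box 3 n \ T) (hb : b ∈ box 3 n \ T) :
    screening n T a b =
      (plusCurrentSumAvoid (freeBoxGraph 3 n) (boxCore 3 n) (criticalBeta 3)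
            (freeBoxBonds 3 n (edgesTouching (zdGraph 3) T)) (boxSources 3 n ({a} ∆ {b})) /
          plusCurrentSum (freeBoxGraph 3 n) (boxCore 3 n) (criticalBeta 3) (boxSources 3 n ({a} ∆ {b}))) /
        (plusCurrentSumAvoid (freeBoxGraph 3 n) (boxCore 3 n) (criticalBeta 3)
            (freeBoxBonds 3 n (edgesTouching (zdGraph 3) T)) (boxSources 3 n ∅) /
          plusCurrentSum (freeBoxGraph 3 n) (boxCore 3 n) (criticalBeta 3) (boxSources 3 n ∅)) := by
  set β := criticalBeta 3 with hβdef
  have han : a ∈ box 3 n := (Finset.mem_sdiff.1 ha).1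
  have hbn : b ∈ box 3 n := (Finset.mem_sdiff.1 hb).1
  have hAT : ({a} ∆ {b} : Finset (Site 3)) ⊆ box 3 n \ T := pair_symmDiff_subset ha hb
  have hAn : ({a} ∆ {b} : Finset (Site 3)) ⊆ box 3 n := pair_symmDiff_subset han hbn
  rw [sourcedAvoid_eq_div 3 n β hF hAn, sourcedAvoid_eq_div 3 n β hF (Finset.empty_subset _),
    isingExpect_spinProduct_expNegBonds_hole β hF hAT,
    isingExpect_spinProduct_expNegBonds_hole β hF (Finset.empty_subset _), isingCorr_empty, isingCorr_empty,
    div_one, one_mul]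
  have hE := (isingExpect_pos (zdGraph 3) (box 3 n) β 0 .free (measurable_expNegBonds 3 β (edgesTouching (zdGraph 3) T))
    fun _ => Real.exp_pos _).ne'
  unfold screening boxTwoPoint
  rw [isingTwoPoint_free_eq_isingCorr_symmDiff, isingTwoPoint_free_eq_isingCorr_symmDiff, Finset.sdiff_empty,
    div_right_comm, mul_div_cancel_right₀ _ hE]

/-- **The current dictionary of the screening ratio** (registered form of `screening_eq_sourcedAvoid_div`). [cite: AizenmanDuminilCopinSidoraviciusCMP2015, §2.2, eqs. (2.13)–(2.14)] -/
theorem screening_current_dictionary : ∀ (n : ℕ) (T : Finset (Site 3)), edgesTouching (zdGraph 3) T ⊆ edgesIn (zdGraph 3) (box 3 n) → ∀ a b : Site 3, a ∈ box 3 n \ T → b ∈ box 3 n \ T → screening n T a b = (plusCurrentSumAvoid (freeBoxGraph 3 n) (boxCore 3 n) (criticalBeta 3) (freeBoxBonds 3 n (edgesTouching (zdGraph 3) T)) (boxSources 3 n ({a} ∆ {b})) / plusCurrentSum (freeBoxGraph 3 n) (boxCore 3 n) (criticalBeta 3) (boxSources 3 n ({a} ∆ {b}))) / (plusCurrentSumAvoid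 (freeBoxGraph 3 n) (boxCore 3 n) (criticalBeta 3) (freeBoxBonds 3 n (edgesTouching (zdGraph 3) T)) (boxSources 3 n ∅) / plusCurrentSum (freeBoxGraph 3 n) (boxCore 3 n) (criticalBeta 3) (boxSources 3 n ∅)) :=
  fun _ _ hF _ _ ha hb => screening_eq_sourcedAvoid_div hF ha hb

/-! ### Octave drops are proper fractions; small drops suffice -/

/-- **An octave drop of the ladder is a proper fraction**: if `A(2^{k+1};m) ≤ (1-c)·A(2^k;m)` with
`m ≥ 2^{k+3}` and `n ≥ 2m+1`, then `c < 1` (both rungs are positive, `pinchScreen_pos`). So the hypothesis of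
`HazardRelocation` is void for `c ≥ 1`. [folklore] -/
theorem lt_one_of_pinchScreen_drop {k m n : ℕ} {c : ℝ} (hm : 2 ^ (k + 3) ≤ m) (hn : 2 * m + 1 ≤ n)
    (h : pinchScreen n (2 ^ (k + 1)) m ≤ (1 - c) * pinchScreen n (2 ^ k) m) : c < 1 := by
  have hk1 : 2 ^ (k + 1) < m := lt_of_lt_of_le (Nat.pow_lt_pow_right (by norm_num) (by omega)) hm
  have hk0 : 2 ^ k < m := lt_of_le_of_lt (Nat.pow_le_pow_right two_pos (Nat.le_succ k)) hk1
  have ha' := pinchScreen_pos (Nat.one_le_two_pow) hk1 hn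
  have ha := pinchScreen_pos (Nat.one_le_two_pow) hk0 hn
  by_contra hc
  push Not at hc
  nlinarith

/-- **Small drops suffice**: `HazardRelocation` follows from its restriction to drops `c < 1` (indeed to
`c ≤ c₀` for any fixed `c₀ > 0`): a drop `≥ c` is in particular a drop `≥ min(c, 1/2)`. [folklore] -/
theorem hazardRelocation_of_lt_one
    (h : ∀ c : ℝ, 0 < c → c < 1 → ∃ c' : ℝ, 0 < c' ∧ ∀ᶠ k : ℕ in atTop, ∀ m : ℕ, 2 ^ (k + 3) ≤ m →
      ∀ᶠ n : ℕ in atTop,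
        (0 < pinchScreen n (2 ^ k) m ∧ pinchScreen n (2 ^ (k + 1)) m ≤ (1 - c) * pinchScreen n (2 ^ k) m) →
          (0 < pinchScreen n (2 ^ k) (2 ^ (k + 3)) ∧
            pinchScreen n (2 ^ (k + 1)) (2 ^ (k + 3)) ≤ (1 - c') * pinchScreen n (2 ^ k) (2 ^ (k + 3)))) :
    HazardRelocation := by
  intro c hc
  obtain ⟨c', hc', hk⟩ := h (min c (1 / 2)) (lt_min hc one_half_pos) (lt_of_le_of_lt (min_le_right _ _) one_half_lt_one)
  refine ⟨c', hc', hk.mono fun k hkk m hm => (hkk m hm).mono fun n hn hyp => hn ⟨hyp.1, ?_⟩⟩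
  have hmin : min c (1 / 2) ≤ c := min_le_left _ _
  nlinarith [hyp.1, hyp.2]

/-! ### `HazardRelocation` from far-end comparability of the octave hazard -/

/-- **HAZARD RELOCATION FROM DROP COMPARABILITY (up to constants).** Write `A(r;m) = pinchScreen n r m`,
`M = 2^{k+3}` and `D(k;m) = A(2^k;m) - A(2^{k+1};m) ≥ 0` for the tilted probability that the octave-`k` piece
`C_{2^{k+1}} ∖ C_{2^k}` of the explored duplicated cluster cuts the pinned probe. IF the relative drop
`D(k;m)/A(2^k;m)` at a far scale `m ≥ M` is at most `K` times the relative drop `D(k;M)/A(2^k;M)` at the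
bounded-aspect scale (cross-multiplied: no division), uniformly in large `k`, `m ≥ M` and large `n`, THEN
`HazardRelocation` holds with `c' = c/K` (the positivity conjunct is `pinchScreen_pos`). This is the exact
up-to-constants far-end insensitivity the stub needs; comparability of the SURVIVALS `A(2^{k+1};·)/A(2^k;·)`
up to a constant `K > 1` would only transfer drops `c > 1 - 1/K`. [cite: AizenmanDuminilCopinAnnals2021, §6.2] -/
theorem hazardRelocation_of_dropComparability :
    (∃ K : ℝ, 0 < K ∧ ∀ᶠ k : ℕ in atTop, ∀ m : ℕ, 2 ^ (k + 3) ≤ m → ∀ᶠ n : ℕ in atTop,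
      (pinchScreen n (2 ^ k) m - pinchScreen n (2 ^ (k + 1)) m) * pinchScreen n (2 ^ k) (2 ^ (k + 3)) ≤
        K * ((pinchScreen n (2 ^ k) (2 ^ (k + 3)) - pinchScreen n (2 ^ (k + 1)) (2 ^ (k + 3))) *
          pinchScreen n (2 ^ k) m)) →
    HazardRelocation := by
  rintro ⟨K, hK0, hK⟩ c hc
  refine ⟨c / K, div_pos hc hK0, ?_⟩
  filter_upwards [hK] with k hk m hm
  filter_upwards [hk m hm, pinchScreen_dyadic_eventually_pos k (2 ^ (k + 3)) le_rfl] with n hn hb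
  rintro ⟨ha, hdrop⟩
  refine ⟨hb, ?_⟩
  set a := pinchScreen n (2 ^ k) m with ha_def
  set a' := pinchScreen n (2 ^ (k + 1)) m with ha'_def
  set b := pinchScreen n (2 ^ k) (2 ^ (k + 3)) with hb_def
  set b' := pinchScreen n (2 ^ (k + 1)) (2 ^ (k + 3)) with hb'_def
  -- `c·a·b ≤ D·b ≤ K·D'·a`, divide by `K·a > 0`
  have h1 : c * a * b ≤ (a - a') * b := mul_le_mul_of_nonneg_right (by nlinarith) hb.le
  have h2 : c * b ≤ K * (b - b') := le_of_mul_le_mul_right (by nlinarith [h1.trans hn]) ha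
  have h3 : c / K * b ≤ b - b' := by
    rw [div_mul_eq_mul_div, div_le_iff₀ hK0]; nlinarith
  nlinarith

/-- **HAZARD RELOCATION FROM ASYMPTOTIC RATIO INSENSITIVITY OF THE SURVIVALS.** IF for every `δ > 0`,
for all large `k`, every `m ≥ M = 2^{k+3}` and all large `n`,
`A(2^{k+1};M)·A(2^k;m) ≤ (1+δ)·A(2^{k+1};m)·A(2^k;M)` (the octave-`k` survival ratio of the tilted pinned
probe with far ends at the bounded-aspect scale exceeds the one with far ends at scale `m` by at most a factor
`1+δ`, `δ → 0` along the octaves), THEN `HazardRelocation` holds with `c' = c/2` (`δ = c/2`). The asymptotic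
form is needed here: a fixed factor `1+δ` only transfers drops `c > δ/(1+δ)`. [cite: Panis2025, Thm 3.1] -/
theorem hazardRelocation_of_ratioInsensitivity :
    (∀ δ : ℝ, 0 < δ → ∀ᶠ k : ℕ in atTop, ∀ m : ℕ, 2 ^ (k + 3) ≤ m → ∀ᶠ n : ℕ in atTop,
      pinchScreen n (2 ^ (k + 1)) (2 ^ (k + 3)) * pinchScreen n (2 ^ k) m ≤
        (1 + δ) * (pinchScreen n (2 ^ (k + 1)) m * pinchScreen n (2 ^ k) (2 ^ (k + 3)))) →
    HazardRelocation := by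
  intro hR c hc
  refine ⟨c / 2, half_pos hc, ?_⟩
  filter_upwards [hR (c / 2) (half_pos hc)] with k hk m hm
  filter_upwards [hk m hm, pinchScreen_dyadic_eventually_pos k (2 ^ (k + 3)) le_rfl] with n hn hb
  rintro ⟨ha, hdrop⟩
  refine ⟨hb, ?_⟩
  set a := pinchScreen n (2 ^ k) m with ha_def
  set a' := pinchScreen n (2 ^ (k + 1)) m with ha'_def
  set b := pinchScreen n (2 ^ k) (2 ^ (k + 3)) with hb_def
  set b' := pinchScreen n (2 ^ (k + 1)) (2 ^ (k + 3)) with hb'_def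
  -- `b'·a ≤ (1+c/2)·a'·b ≤ (1+c/2)(1-c)·a·b ≤ (1-c/2)·a·b`, divide by `a > 0`
  have h1 : (1 + c / 2) * (a' * b) ≤ (1 + c / 2) * ((1 - c) * a * b) :=
    mul_le_mul_of_nonneg_left (mul_le_mul_of_nonneg_right hdrop hb.le) (by linarith)
  have h2 : b' * a ≤ (1 - c / 2) * b * a := by nlinarith [h1, hn, mul_pos ha hb, sq_nonneg c]
  exact le_of_mul_le_mul_right h2 ha

end Summit.CriticalPhenomena.Ising3DConformalLimit.EnergyNotSigmaSquaredGapForcesFarMerging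

end
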